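import Summits.ResolutionOfSingularities.ResolutionOfSingularities.Theorems.FrobeniusLadderFInjectiveMacaulayficationFiniteModificationConductor
import Literature.AlgebraicGeometry.Resolution.AlterationsNormalizationReduction
import Literature.AlgebraicGeometry.Resolution.BlowupsProduct
import Literature.AlgebraicGeometry.Resolution.MarkedIdealsLemmas
import HarnessLib

/-!
# The uniform conductor bound and the conductor-type ideal sheaf `𝔠_N = I^N·g_*𝒪_{X₃} ∩ 𝒪_{X₂}`
# (S-V1 of the FC′ r2 rung; crux `FInjectiveMacaulayfication` stmt-ResolutionOfSingularities-15315, chain w45a)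

[OURS · L1 W4.5a · res-D-pv-019 AS res-L1-w45a-stub-7] Support file (`--supports stmt-ResolutionOfSingularities-15315
--as helper`) for the crux `FrobeniusLadder.FInjectiveMacaulayfication`; NOT a statement of any manuscript; no definitions,
no named facts; AI-written (AI review is weaker than expert review). With `…FiniteModificationConductor.lean` it
discharges, in generic form, the typed input S-V1 `FiniteModificationOfBlowup.ConductorIdealExists` of
res-L1-w45a-strat-1's `FCRungsSig.lean` v2.4 §B8 (the verbatim wrapper imports this file and `…FiniteModificationOfBlowup`).
All PROVED:

* `forall_mem_map_pow_mem_range` — `I(U)ᴺ·B ⊆ φ(A)` in ideal form;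
* **`exists_uniform_pow_mul_le_range`** — THE UNIFORM BOUND: for `g : X₃ → X₂` finite surjective, `X₃` integral, `X₂`
  Noetherian, stalk-isomorphic off `supp I`, ONE exponent `N ≥ 1` with `I(U)ᴺ·Γ(X₃, g⁻¹U) ⊆ g^*Γ(X₂, U)` for EVERY affine
  open `U` (maximum of the affine bounds over a finite affine cover; on an arbitrary affine `U` the inclusion holds near
  each point on an open basic in `U` and in a member of the cover — localising down, then up — and the multipliers so
  obtained generate the unit ideal by the radical lemma with `f = 1`);
* `ideal_ker_eq` — the ideal sheaf `𝔠_N := ker(𝒪_{X₂} → g_*𝒪_{Z_N})`, `Z_N = V((I𝒪_{X₃})ᴺ) ⊆ X₃` (Mathlib's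
  `Scheme.Hom.ker`), has sections `φ⁻¹(I(U)ᴺ·B)` on every affine open;
* **`exists_stable_idealSheaf`** — the shape of S-V1: for `g` finite surjective between integral schemes, `X₂`
  Noetherian, `I ≠ 0` an effective Cartier divisor off whose support `g` is a stalk isomorphism, the ideal sheaf `𝔠_N`
  (`N` the uniform bound) is non-zero, has `supp 𝔠_N = supp I`, pulls back to the effective Cartier divisor
  `(I𝒪_{X₃})ᴺ`, and is `g_*𝒪_{X₃}`-STABLE: `𝔠_N(U)·B ⊆ φ(𝔠_N(U))` on every affine open `U`.

Sources (method): folklore (conductor of a finite birational extension); Stacks Project Tags 01WS, 0806 and Görtz–Wedhorn I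
(13.19) for effective Cartier divisors / blow-ups. Nothing is cited as a premise.
-/

-- single-problem summit: the doubled namespace component is forced
set_option linter.dupNamespace false

noncomputable section

open CategoryTheory CategoryTheory.Limits AlgebraicGeometry TopologicalSpace
open Literature.AlgebraicGeometry.Resolution

namespace Summit.ResolutionOfSingularities.ResolutionOfSingularities.Theorems.FInjectiveMacaulayfication.FiniteModificationConductor

universe u

variable {X₂ X₃ : Scheme.{u}} (g : X₃ ⟶ X₂)

/-! ## The uniform conductor bound -/

section Uniform

/-- **Stability of the image under a power of `I(U)`**: if `I(U)^N · B ⊆ g^*(A)` on `U`, then every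
element of the extended ideal `I(U)^N · B` lies in `g^*(A)` (and so does every `B`-multiple).
[plumbing] -/
theorem forall_mem_map_pow_mem_range (U : X₂.affineOpens) (I₀ : Ideal Γ(X₂, U)) (N : ℕ)
    (hN : ∀ a ∈ I₀ ^ N, ∀ b : Γ(X₃, g ⁻¹ᵁ (U : X₂.Opens)),
      ∃ a' : Γ(X₂, U), (g.app U).hom a * b = (g.app U).hom a') :
    ∀ c ∈ (I₀ ^ N).map (g.app U).hom, c ∈ Set.range (g.app U).hom := by
  intro c hc
  suffices h : ∀ r, r * c ∈ Set.range (g.app U).hom by simpa using h 1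
  refine Submodule.span_induction (p := fun c _ => ∀ r, r * c ∈ Set.range (g.app U).hom)
    ?_ ?_ ?_ ?_ hc
  · rintro _ ⟨a, ha, rfl⟩ r
    obtain ⟨a', ha'⟩ := hN a ha r
    exact ⟨a', by rw [mul_comm, ha']⟩
  · exact fun r => ⟨0, by rw [mul_zero, map_zero]⟩
  · intro c₁ c₂ _ _ h₁ h₂ r
    obtain ⟨a₁, h₁⟩ := h₁ r
    obtain ⟨a₂, h₂⟩ := h₂ r
    exact ⟨a₁ + a₂, by rw [map_add, h₁, h₂, mul_add]⟩
  · intro r' c _ h r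
    obtain ⟨a', h'⟩ := h (r * r')
    exact ⟨a', by rw [h', smul_eq_mul, mul_assoc]⟩

/-- **THE UNIFORM CONDUCTOR BOUND.** For `g : X₃ → X₂` finite surjective, `X₃` integral, `X₂`
Noetherian, stalk-isomorphic off the support of the ideal sheaf `I`, there is ONE exponent `N ≥ 1`
with `I(U)ᴺ · Γ(X₃, g⁻¹U) ⊆ g^*Γ(X₂, U)` for EVERY affine open `U ⊆ X₂`: take the maximum of the
affine bounds (`exists_pow_mul_le_range`) over a finite affine cover; on an arbitrary affine `U`
the inclusion holds near each point (on an open that is basic in `U` and in a member of the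
cover: `mem_range_of_mem_map_of_forall_mem_range` down, `exists_pow_mul_eq_of_restrict_mem_range`
up), and the multipliers so obtained generate the unit ideal (`mem_radical_of_forall_exists_basicOpen`
with `f = 1`). [folklore] -/
theorem exists_uniform_pow_mul_le_range [IsIntegral X₃] [IsFinite g] [IsNoetherian X₂]
    (hsurj : Function.Surjective g.base) (I : X₂.IdealSheafData)
    (hiso : ∀ x₃ : X₃, g.base x₃ ∉ (I.support : Set X₂) → IsIso (g.stalkMap x₃)) :
    ∃ N : ℕ, 0 < N ∧ ∀ (U : X₂.affineOpens), ∀ a ∈ I.ideal U ^ N,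
      ∀ b : Γ(X₃, g ⁻¹ᵁ (U : X₂.Opens)), ∃ a' : Γ(X₂, U), (g.app U).hom a * b = (g.app U).hom a' := by
  classical
  -- a finite affine cover `t` of `X₂` and the maximum `N₀` of the affine bounds over it
  obtain ⟨t, ht⟩ := isCompact_univ.elim_finite_subcover
    (fun U : X₂.affineOpens => ((U : X₂.Opens) : Set X₂)) (fun U => (U : X₂.Opens).isOpen)
    (fun x _ => by
      have hx : x ∈ ((⨆ U : X₂.affineOpens, (U : X₂.Opens) : X₂.Opens) : Set X₂) := by
        rw [iSup_affineOpens_eq_top X₂]; trivial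
      simpa only [Opens.coe_iSup] using hx)
  choose N hN using fun U : X₂.affineOpens => exists_pow_mul_le_range g hsurj I hiso U
  refine ⟨t.sup N + 1, Nat.succ_pos _, fun U a ha b => ?_⟩
  -- the ideal of multipliers of `c := g^*(a) · b` into `A = Γ(X₂, U)`
  let 𝔞 : Ideal Γ(X₂, U) :=
    { carrier := {s | ∃ a' : Γ(X₂, U), (g.app U).hom s * ((g.app U).hom a * b) = (g.app U).hom a'}
      add_mem' := by
        rintro s₁ s₂ ⟨a₁', h₁⟩ ⟨a₂', h₂⟩
        exact ⟨a₁' + a₂', by rw [map_add, add_mul, h₁, h₂, map_add]⟩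
      zero_mem' := ⟨0, by rw [map_zero, zero_mul]⟩
      smul_mem' := by
        rintro r s ⟨a', h⟩
        exact ⟨r * a', by rw [smul_eq_mul, map_mul, mul_assoc, h, map_mul]⟩ }
  have h𝔞 : ∀ s, s ∈ 𝔞 ↔
      ∃ a' : Γ(X₂, U), (g.app U).hom s * ((g.app U).hom a * b) = (g.app U).hom a' :=
    fun _ => Iff.rfl
  -- it suffices that `1 ∈ 𝔞`, i.e. `1 ∈ √𝔞`, i.e. every point of `U` lies in some `D(s)`, `s ∈ 𝔞`
  suffices h1 : (1 : Γ(X₂, U)) ∈ 𝔞.radical by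
    obtain ⟨n, hn⟩ := h1
    rw [one_pow] at hn
    obtain ⟨a', ha'⟩ := (h𝔞 1).mp hn
    exact ⟨a', by rw [map_one, one_mul] at ha'; exact ha'⟩
  refine mem_radical_of_forall_exists_basicOpen U 𝔞 1 fun x hx1 => ?_
  have hxU : x ∈ (U : X₂.Opens) := X₂.basicOpen_le _ hx1
  -- a member `Ui ∋ x` of the cover and an open `O ∋ x` basic in both `U` and `Ui`
  obtain ⟨Ui, hUit, hxUi⟩ : ∃ Ui ∈ t, x ∈ ((Ui : X₂.Opens) : Set X₂) := by
    simpa only [Set.mem_iUnion, exists_prop] using ht (Set.mem_univ x)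
  obtain ⟨h, h', e, hxh⟩ := exists_basicOpen_le_affine_inter U.2 Ui.2 x ⟨hxU, hxUi⟩
  have hOU : X₂.basicOpen h ≤ (U : X₂.Opens) := X₂.basicOpen_le h
  have hOUi : X₂.basicOpen h ≤ (Ui : X₂.Opens) := e ▸ X₂.basicOpen_le h'
  have hle : g ⁻¹ᵁ X₂.basicOpen h ≤ g ⁻¹ᵁ (U : X₂.Opens) := fun y hy => hOU hy
  have hle' : g ⁻¹ᵁ X₂.basicOpen h ≤ g ⁻¹ᵁ (Ui : X₂.Opens) := fun y hy => hOUi hy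
  -- on `Ui` the bound `N₀ ≥ N Ui` holds in stable form
  have hNi : ∀ a₀ ∈ I.ideal Ui ^ (t.sup N + 1), ∀ b₀ : Γ(X₃, g ⁻¹ᵁ (Ui : X₂.Opens)),
      ∃ a' : Γ(X₂, Ui), (g.app Ui).hom a₀ * b₀ = (g.app Ui).hom a' := fun a₀ ha₀ b₀ =>
    hN Ui a₀ (Ideal.pow_le_pow_right ((Finset.le_sup hUit).trans (Nat.le_succ _)) ha₀) b₀
  have hJi := forall_mem_map_pow_mem_range g Ui (I.ideal Ui) (t.sup N + 1) hNi
  -- the restriction `z` of `c` to `g⁻¹O` lies in `(I(Ui)^N₀ · B_i) · Γ(X₃, g⁻¹O)`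
  have hres : (X₂.presheaf.map (homOfLE hOU).op).hom a ∈
      ((I.ideal Ui ^ (t.sup N + 1)).map (X₂.presheaf.map (homOfLE hOUi).op).hom) := by
    have h1 := I.map_ideal (U := X₂.affineBasicOpen h) (V := U) hOU
    have h2 := I.map_ideal (U := X₂.affineBasicOpen h) (V := Ui) hOUi
    have h12 : (I.ideal U).map (X₂.presheaf.map (homOfLE hOU).op).hom =
        (I.ideal Ui).map (X₂.presheaf.map (homOfLE hOUi).op).hom := h1.trans h2.symm
    have hEq : (I.ideal U ^ (t.sup N + 1)).map (X₂.presheaf.map (homOfLE hOU).op).hom =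
        (I.ideal Ui ^ (t.sup N + 1)).map (X₂.presheaf.map (homOfLE hOUi).op).hom :=
      (Ideal.map_pow _ _ _).trans
        ((congrArg (fun J => J ^ (t.sup N + 1)) h12).trans (Ideal.map_pow _ _ _).symm)
    exact hEq.le (Ideal.mem_map_of_mem _ ha)
  have hnat : ((g.app (X₂.basicOpen h)).hom).comp (X₂.presheaf.map (homOfLE hOUi).op).hom =
      ((X₃.presheaf.map (homOfLE hle').op).hom).comp (g.app Ui).hom := by
    have := g.naturality (homOfLE hOUi).op
    exact (congrArg (fun f => f.hom) this :)
  have hz : (X₃.presheaf.map (homOfLE hle).op).hom ((g.app U).hom a * b) ∈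
      ((I.ideal Ui ^ (t.sup N + 1)).map (g.app Ui).hom).map (X₃.presheaf.map (homOfLE hle').op).hom := by
    rw [map_mul, Ideal.map_map, ← hnat, ← Ideal.map_map]
    refine Ideal.mul_mem_right _ _ (?_)
    have : (X₃.presheaf.map (homOfLE hle).op).hom ((g.app U).hom a) =
        (g.app (X₂.basicOpen h)).hom ((X₂.presheaf.map (homOfLE hOU).op).hom a) := by
      change (g.app U ≫ X₃.presheaf.map (homOfLE hle).op).hom a =
        (X₂.presheaf.map (homOfLE hOU).op ≫ g.app (X₂.basicOpen h)).hom a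
      rw [g.naturality]
      rfl
    rw [this]
    exact Ideal.mem_map_of_mem _ hres
  -- down to `O` (from `Ui`), then up to `U`
  have hzr := mem_range_of_mem_map_of_forall_mem_range g Ui h' (X₂.basicOpen h) e hOUi hle' _ hJi
    _ hz
  obtain ⟨M, a', hM⟩ := exists_pow_mul_eq_of_restrict_mem_range g U h (X₂.basicOpen h) rfl hle
    _ hzr
  refine ⟨h ^ M, (h𝔞 _).mpr ⟨a', hM⟩, ?_⟩
  rw [X₂.mem_basicOpen (h ^ M) x hxU, map_pow]
  exact ((X₂.mem_basicOpen h x hxU).mp hxh).pow M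

end Uniform

/-! ## The conductor-type ideal sheaf `𝔠_N` and its properties -/

section IdealSheaf

open Scheme.IdealSheafData

/-- **Sections of `𝔠_N := ker(𝒪_{X₂} → g_*𝒪_{Z_N})`, `Z_N = V((I𝒪_{X₃})ᴺ)`:** on an affine open `U`,
`𝔠_N(U) = φ⁻¹(I(U)ᴺ · Γ(X₃, g⁻¹U))`. [folklore] -/
theorem ideal_ker_eq [IsAffineHom g] (I : X₂.IdealSheafData) (N : ℕ) (U : X₂.affineOpens) :
    (((I.comap g) ^ N).subschemeι ≫ g).ker.ideal U =
      ((I.ideal U ^ N).map (g.app U).hom).comap (g.app U).hom := by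
  have hV : IsAffineOpen (g ⁻¹ᵁ (U : X₂.Opens)) := U.2.preimage g
  rw [Scheme.Hom.ker_apply, Scheme.Hom.comp_app]
  ext a
  change (((I.comap g) ^ N).subschemeι.app (g ⁻¹ᵁ (U : X₂.Opens))).hom ((g.app U).hom a) = 0 ↔ _
  rw [← RingHom.mem_ker, ker_subschemeι_app _ ⟨g ⁻¹ᵁ (U : X₂.Opens), hV⟩, Ideal.mem_comap,
    ideal_pow, Pi.pow_apply, ideal_comap_of_le g I U ⟨g ⁻¹ᵁ (U : X₂.Opens), hV⟩ le_rfl,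
    Scheme.Hom.appLE_eq_app, Ideal.map_pow]

/-- `φ(φ⁻¹(J)) · B = J` for `J = I(U)ᴺ·B` an extended ideal. [plumbing] -/
theorem map_comap_map_eq {A B : Type*} [CommRing A] [CommRing B] (φ : A →+* B) (K : Ideal A) :
    ((K.map φ).comap φ).map φ = K.map φ :=
  le_antisymm Ideal.map_comap_le (Ideal.map_mono Ideal.le_comap_map)

/-- **THE STABLE IDEAL SHEAF (shape of S-V1 `ConductorIdealExists`).** For `g : X₃ → X₂` finite surjective
between integral schemes, `X₂` Noetherian, and `I ≠ 0` an effective Cartier divisor on `X₂` off whose support `g`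
is a stalk isomorphism, there is a non-zero ideal sheaf `𝔠` on `X₂` with `supp 𝔠 = supp I`, with `𝔠𝒪_{X₃}` an
effective Cartier divisor, and `g_*𝒪_{X₃}`-stable on every affine open. WITNESS: `𝔠 = 𝔠_N` for the uniform
conductor bound `N` (`exists_uniform_pow_mul_le_range`); `𝔠_N𝒪_{X₃} = (I𝒪_{X₃})ᴺ`. [folklore assembly] -/
theorem exists_stable_idealSheaf [IsIntegral X₂] [IsNoetherian X₂] [IsIntegral X₃] [IsFinite g]
    (hsurj : Function.Surjective g.base) (I : X₂.IdealSheafData) (hI : I ≠ ⊥)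
    (hIc : IsEffectiveCartier I)
    (hiso : ∀ x₃ : X₃, g.base x₃ ∉ (I.support : Set X₂) → IsIso (g.stalkMap x₃)) :
    ∃ 𝔠 : X₂.IdealSheafData, 𝔠 ≠ ⊥ ∧ 𝔠.support = I.support ∧ IsEffectiveCartier (𝔠.comap g) ∧
      ∀ (U : X₂.affineOpens) (b : Γ(X₃, g ⁻¹ᵁ (U : X₂.Opens))),
        b ∈ Ideal.map (g.app (U : X₂.Opens)).hom (𝔠.ideal U) →
          ∃ a ∈ 𝔠.ideal U, (g.app (U : X₂.Opens)).hom a = b := by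
  obtain ⟨N, hN0, hN⟩ := exists_uniform_pow_mul_le_range g hsurj I hiso
  have hideal := ideal_ker_eq g I N
  -- `I^N ≤ 𝔠_N`
  have hIN : I ^ N ≤ (((I.comap g) ^ N).subschemeι ≫ g).ker := by
    intro U
    rw [hideal, ideal_pow, Pi.pow_apply]
    exact Ideal.le_comap_map
  refine ⟨(((I.comap g) ^ N).subschemeι ≫ g).ker, ?_, ?_, ?_, ?_⟩
  · -- non-zero
    intro h
    have h1 : I ^ N = ⊥ := le_bot_iff.mp (h ▸ hIN)
    have h2 : I.support = ⊤ := by rw [← support_pow I N hN0.ne', h1, support_bot]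
    exact hI (support_eq_top_iff.mp h2)
  · -- support
    refine le_antisymm ?_ ?_
    · exact (support_antitone hIN).trans_eq (support_pow I N hN0.ne')
    · intro x hx
      obtain ⟨U, hU, hxU, -⟩ :=
        exists_isAffineOpen_mem_and_subset (X := X₂) (x := x) (U := ⊤) (Opens.mem_top x)
      rw [mem_support_iff_of_mem (I := (((I.comap g) ^ N).subschemeι ≫ g).ker) (U := ⟨U, hU⟩) hxU,
        Scheme.mem_zeroLocus_iff]
      intro a ha hxa
      obtain ⟨x₃, rfl⟩ := hsurj x
      have hx₃ : x₃ ∈ X₃.basicOpen ((g.app U).hom a) := by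
        rw [← Scheme.preimage_basicOpen]; exact hxa
      have hxV : x₃ ∈ g ⁻¹ᵁ U := hxU
      have hsupp : x₃ ∈ (I.comap g).support := by
        change x₃ ∈ ((I.comap g).support : Set X₃)
        rw [support_comap]; exact hx
      rw [mem_support_iff_of_mem (I := I.comap g) (U := ⟨g ⁻¹ᵁ U, hU.preimage g⟩) hxV,
        Scheme.mem_zeroLocus_iff] at hsupp
      refine hsupp ((g.app U).hom a) ?_ hx₃
      rw [ideal_comap_of_le g I ⟨U, hU⟩ ⟨g ⁻¹ᵁ U, hU.preimage g⟩ le_rfl, Scheme.Hom.appLE_eq_app]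
      rw [hideal] at ha
      exact Ideal.pow_le_self hN0.ne' (Ideal.map_pow (g.app U).hom (I.ideal ⟨U, hU⟩) N ▸ ha)
  · -- `𝔠_N𝒪_{X₃} = (I𝒪_{X₃})^N` is an effective Cartier divisor
    haveI : IsDominant g := ⟨hsurj.denseRange⟩
    have hEq : (((I.comap g) ^ N).subschemeι ≫ g).ker.comap g = (I.comap g) ^ N := by
      refine ext_of_iSup_eq_top (fun p : {p : X₃.affineOpens × X₂.affineOpens //
          (p.1 : X₃.Opens) ≤ g ⁻¹ᵁ (p.2 : X₂.Opens)} => p.1.1)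
        (iSup_affineOpens_le_preimage_eq_top g) fun p => ?_
      obtain ⟨⟨V, U⟩, hVU⟩ := p
      rw [ideal_comap_of_le g _ U V hVU, hideal, ideal_pow, Pi.pow_apply,
        ideal_comap_of_le g I U V hVU, ← Ideal.map_pow]
      have happ : (g.appLE U V hVU).hom =
          (X₃.presheaf.map (homOfLE hVU).op).hom.comp (g.app U).hom := by
        rw [Scheme.Hom.appLE, CommRingCat.hom_comp]
      rw [happ, ← Ideal.map_map, ← Ideal.map_map, map_comap_map_eq]
    rw [hEq]
    exact (hIc.comap_of_isDominant g).pow N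
  · -- stability
    intro U b hb
    rw [hideal, map_comap_map_eq] at hb
    obtain ⟨a, ha⟩ := forall_mem_map_pow_mem_range g U (I.ideal U) N (hN U) b hb
    refine ⟨a, ?_, ha⟩
    rw [hideal, Ideal.mem_comap, ha]
    exact hb

end IdealSheaf

end Summit.ResolutionOfSingularities.ResolutionOfSingularities.Theorems.FInjectiveMacaulayfication.FiniteModificationConductor

end
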